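import Summits.BirchSwinnertonDyer.BirchSwinnertonDyer.Theorems.GenusKolyvaginAtTwoGenusPrimitiveSupplyAtTwoTwistLocalConditionKummer
import HarnessLib

/-!
# Route `GenusKolyvaginAtTwo`, crux #2 `GenusPrimitiveSupplyAtTwo` (stmt-BirchSwinnertonDyer-22136):
# the local untwisting at a NON-split place — `Γ_E`-equivariant up to the quadratic character (Mazur–Rubin Remark 2.4,
# local form), intertwined with the `2`-torsion identification

Width seat `bsd-line-gk2-p5` g8 (cell `bsd-f1-sign2`, SUPPLY lineage), sixth file of the series (crux workfile
`Lines/genus-supply-mr-instantiation.md`). THEOREMS ONLY (no definition, no named fact, no `sorry`); helper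
`--supports stmt-BirchSwinnertonDyer-22136`; no item is closed; BSD is not proved by any of this.

WHY. The remaining local input of the Mazur–Rubin instantiation for the twist pair `(E, E^{(d)})` at `p = 2` is the comparison
of the two Kummer conditions inside `H¹(K_v, E[2])` at the places where `d` is NOT a square in `K_v` — the TRANSVERSALITY at the
ramified twisting prime (MR Lemma 2.11, the hypothesis `htr` of `natCard_selmerGroup_twist_mul_two_eq_of_local`) and, on `Δ > 0`,
at the real place (MR Lemma 2.9 / Kramer Prop. 6, T-A/T-V). Its tool is the untwisting `(x,y) ↦ (x/ι(θ)², y/ι(θ)³)` over `K̄_E`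
for an ARBITRARY `K`-field `E`: it commutes with `σ ∈ Γ_E` when `σ ι(θ) = ι(θ)` and ANTI-commutes (`θ_E(σQ) = −σ θ_E(Q)`) when
`σ ι(θ) = −ι(θ)` (one of the two always holds: `ι(θ)² = d`), and it is intertwined ON THE NOSE with the `Γ_K`-equivariant
`ψ : E^{(d)}[2] ≃+ E[2]` of p618532/p619414 by the maps on points along `ι`. So a local Kummer cocycle `τ ↦ τQ − Q` of `E^{(d)}`
is carried to `τ ↦ χ_d(τ)·τR − R`, `R = θ_E(Q)` — the formula behind MR Lemmas 2.9–2.11.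

* `localUntwist_smul_of_fix`, `localUntwist_smul_of_neg` — the sign rule for the substitution `ι(C_θ)` over `K̄_E`;
* `exists_addEquiv_geomTorsion_two_localSquare_signed` — **for `W/K` (`2 ≠ 0`), `d ≠ 0`, `Wd = C • W^{(d)}`: a `Γ_K`-equivariant
  `ψ : Wd[2] ≃+ W[2]` and, at EVERY `K`-field `E`, an additive `θ_E : Wd(K̄_E) ≃+ W(K̄_E)` with `θ_E(σQ) = σθ_E(Q)` if
  `σ ι(√d) = ι(√d)`, `θ_E(σQ) = −σθ_E(Q)` if `σ ι(√d) = −ι(√d)`, the dichotomy itself, and `ι_* (ψ t) = θ_E (ι_* t)` on `Wd[2]`.**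

References: [MazurRubin2010] Remark 2.4, Lemmas 2.9–2.11; [SilvermanAEC2009] X.2 Prop. 2.4, X.5 Cor. 5.4.
-/

set_option linter.dupNamespace false -- tree convention: `Summit.BirchSwinnertonDyer.BirchSwinnertonDyer.Theorems` (summit = sub-problem)
set_option autoImplicit false

noncomputable section

open scoped Classical

namespace Summit.BirchSwinnertonDyer.BirchSwinnertonDyer.Theorems.GenusKolyTwistLocal

open WeierstrassCurve Field
open Literature.NumberTheory.EllipticCurves Literature.NumberTheory.GaloisRepresentations

universe u

/-! ## §15 The sign rule for the local untwisting -/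

section SignRule

variable {K : Type u} [Field K] (V : WeierstrassCurve K) [V.IsCharNeTwoNF] {d : K} (E : Type u) [Field E] [Algebra K E]

omit [V.IsCharNeTwoNF] in
/-- `ι(√d)² = d` in `K̄_E`, so every `σ ∈ Γ_E` maps `ι(√d)` to `± ι(√d)`. [folklore] -/
theorem smul_closureEmb_geomSqrt_eq_or_eq_neg (σ : absoluteGaloisGroup E) :
    (show AlgebraicClosure E ≃ₐ[E] AlgebraicClosure E from σ) (closureEmb (K := K) E (geomSqrt d)) =
        closureEmb (K := K) E (geomSqrt d) ∨
      (show AlgebraicClosure E ≃ₐ[E] AlgebraicClosure E from σ) (closureEmb (K := K) E (geomSqrt d)) =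
        -closureEmb (K := K) E (geomSqrt d) := by
  apply sq_eq_sq_iff_eq_or_eq_neg.mp
  have hsq : (closureEmb (K := K) E (geomSqrt d)) ^ 2 = algebraMap K (AlgebraicClosure E) d := by
    rw [← map_pow, geomSqrt_sq, AlgHom.commutes]
  rw [← map_pow, hsq, IsScalarTower.algebraMap_apply K E (AlgebraicClosure E), AlgEquiv.commutes]

/-- Negation on `V_{K̄_E}` for a model with `a₁ = a₃ = 0` is `(x, y) ↦ (x, -y)`. [folklore] -/
theorem negY_baseChange_closure_of_isCharNeTwoNF (x y : AlgebraicClosure E) :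
    (V.baseChange (AlgebraicClosure E)).toAffine.negY x y = -y := by
  simp [Affine.negY, baseChange, a₁_of_isCharNeTwoNF, a₃_of_isCharNeTwoNF]

omit [V.IsCharNeTwoNF] in
/-- **Sign rule, `+`:** a local untwisting `L` (any additive isomorphism `V^{(d)}(K̄_E) ≃+ V(K̄_E)` given on affine points by
`(x,y) ↦ (x/ι(θ)², y/ι(θ)³)`) COMMUTES with every `σ ∈ Γ_E` fixing `ι(θ)`. [cite: SilvermanAEC2009, X.5 Cor. 5.4] -/
theorem localUntwist_smul_of_fix (L : localPoints (V.quadraticTwist d) E ≃+ localPoints V E)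
    (hL : ∀ (x y : AlgebraicClosure E)
      (h : ((V.quadraticTwist d).baseChange (AlgebraicClosure E)).toAffine.Nonsingular x y),
      ∃ h', L (show localPoints (V.quadraticTwist d) E from .some x y h) =
        (show localPoints V E from .some ((closureEmb (K := K) E (geomSqrt d) ^ 2)⁻¹ * x)
          ((closureEmb (K := K) E (geomSqrt d) ^ 3)⁻¹ * y) h'))
    (σ : absoluteGaloisGroup E)
    (hfix : (show AlgebraicClosure E ≃ₐ[E] AlgebraicClosure E from σ) (closureEmb (K := K) E (geomSqrt d)) =
      closureEmb (K := K) E (geomSqrt d))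
    (Q : localPoints (V.quadraticTwist d) E) : L (σ • Q) = σ • L Q := by
  change ((V.quadraticTwist d).baseChange (AlgebraicClosure E)).toAffine.Point at Q
  rcases Q with _ | ⟨x, y, h⟩
  · rw [← Affine.Point.zero_def]
    change L (σ • (0 : localPoints (V.quadraticTwist d) E)) = σ • L (0 : localPoints (V.quadraticTwist d) E)
    rw [smul_zero, map_zero, smul_zero]
  · obtain ⟨h₁, e₁⟩ := localPoints_smul_some E (V.quadraticTwist d) σ h
    obtain ⟨h₂, e₂⟩ := hL _ _ h₁
    obtain ⟨h₃, e₃⟩ := hL x y h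
    obtain ⟨h₄, e₄⟩ := localPoints_smul_some E V σ h₃
    change L (σ • (show localPoints (V.quadraticTwist d) E from .some x y h)) =
      σ • L (show localPoints (V.quadraticTwist d) E from .some x y h)
    rw [e₁, e₂, e₃, e₄]
    simp only [map_mul, map_inv₀, map_pow, hfix]

/-- **Sign rule, `−`:** the same local untwisting ANTI-commutes (`L(σQ) = −σ L(Q)`) with every `σ ∈ Γ_E` negating `ι(θ)`
(negation on the normal form is `(x, y) ↦ (x, −y)`). [cite: SilvermanAEC2009, X.2 Prop. 2.4, X.5 Cor. 5.4] -/
theorem localUntwist_smul_of_neg (L : localPoints (V.quadraticTwist d) E ≃+ localPoints V E)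
    (hL : ∀ (x y : AlgebraicClosure E)
      (h : ((V.quadraticTwist d).baseChange (AlgebraicClosure E)).toAffine.Nonsingular x y),
      ∃ h', L (show localPoints (V.quadraticTwist d) E from .some x y h) =
        (show localPoints V E from .some ((closureEmb (K := K) E (geomSqrt d) ^ 2)⁻¹ * x)
          ((closureEmb (K := K) E (geomSqrt d) ^ 3)⁻¹ * y) h'))
    (σ : absoluteGaloisGroup E)
    (hneg : (show AlgebraicClosure E ≃ₐ[E] AlgebraicClosure E from σ) (closureEmb (K := K) E (geomSqrt d)) =
      -closureEmb (K := K) E (geomSqrt d))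
    (Q : localPoints (V.quadraticTwist d) E) : L (σ • Q) = -(σ • L Q) := by
  change ((V.quadraticTwist d).baseChange (AlgebraicClosure E)).toAffine.Point at Q
  rcases Q with _ | ⟨x, y, h⟩
  · rw [← Affine.Point.zero_def]
    change L (σ • (0 : localPoints (V.quadraticTwist d) E)) = -(σ • L (0 : localPoints (V.quadraticTwist d) E))
    rw [smul_zero, map_zero, smul_zero, neg_zero]
  · obtain ⟨h₁, e₁⟩ := localPoints_smul_some E (V.quadraticTwist d) σ h
    obtain ⟨h₂, e₂⟩ := hL _ _ h₁
    obtain ⟨h₃, e₃⟩ := hL x y h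
    obtain ⟨h₄, e₄⟩ := localPoints_smul_some E V σ h₃
    change L (σ • (show localPoints (V.quadraticTwist d) E from .some x y h)) =
      -(σ • L (show localPoints (V.quadraticTwist d) E from .some x y h))
    rw [e₁, e₂, e₃, e₄]
    change _ = -(Affine.Point.some _ _ h₄ : (V.baseChange (AlgebraicClosure E)).toAffine.Point)
    rw [Affine.Point.neg_some]
    simp only [Affine.Point.some.injEq]
    refine ⟨?_, ?_⟩
    · simp only [map_mul, map_inv₀, map_pow, hneg, Even.neg_pow (by decide : Even 2)]
    · simp only [negY_baseChange_closure_of_isCharNeTwoNF, map_mul, map_inv₀, map_pow, hneg,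
        Odd.neg_pow (by decide : Odd 3), inv_neg, neg_mul, neg_neg]

end SignRule

/-! ## §16 The signed intertwined pair, at every `K`-field -/

section Signed

variable {K : Type u} [Field K] [NeZero (2 : K)]

/-- **The intertwined untwistings at an ARBITRARY `K`-field `E` (Mazur–Rubin Remark 2.4, local form).** For `W/K` (`2 ≠ 0`),
`d ≠ 0`, `Wd = C • W^{(d)}`: a `Γ_K`-equivariant `ψ : Wd[2] ≃+ W[2]` (untwisting over `K̄` on `2`-torsion) such that at every
`K`-field `E` there is an additive `θ_E : Wd(K̄_E) ≃+ W(K̄_E)` (untwisting over `K̄_E` with `u = ι(√d)`) which COMMUTES with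
`σ ∈ Γ_E` when `σ ι(√d) = ι(√d)` and ANTI-commutes when `σ ι(√d) = −ι(√d)` — one of which holds for every `σ` — and satisfies
`ι_*(ψ t) = θ_E(ι_* t)` for `t ∈ Wd[2]`. At a split place (`√d ∈ E`) only the first case occurs (p619414
`exists_addEquiv_geomTorsion_two_localSquare_of_sq`); at a ramified or inert place the character `σ ↦ ±1` is the local
quadratic character of `K_v(√d)/K_v`, and a local Kummer cocycle `τ ↦ τQ − Q` of `Wd` is carried to `τ ↦ χ(τ)·τR − R`.
[cite: MazurRubin2010, Remark 2.4, Lemmas 2.9–2.11] [cite: SilvermanAEC2009, X.2 Prop. 2.4, X.5 Cor. 5.4] -/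
theorem exists_addEquiv_geomTorsion_two_localSquare_signed (W : WeierstrassCurve K) {d : K} (hd : d ≠ 0)
    {Wd : WeierstrassCurve K} {C : VariableChange K} (hWd : C • W.quadraticTwist d = Wd) :
    ∃ (ψ : geomTorsion Wd (2 : ℤ) ≃+ geomTorsion W (2 : ℤ)),
      (∀ (g : absoluteGaloisGroup K) (t : geomTorsion Wd (2 : ℤ)), ψ (g • t) = g • ψ t) ∧
      ∀ (E : Type u) [Field E] [Algebra K E],
        ∃ θ : localPoints Wd E ≃+ localPoints W E,
          (∀ (σ : absoluteGaloisGroup E),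
            (show AlgebraicClosure E ≃ₐ[E] AlgebraicClosure E from σ) (closureEmb (K := K) E (geomSqrt d)) =
              closureEmb (K := K) E (geomSqrt d) →
            ∀ Q : localPoints Wd E, θ (σ • Q) = σ • θ Q) ∧
          (∀ (σ : absoluteGaloisGroup E),
            (show AlgebraicClosure E ≃ₐ[E] AlgebraicClosure E from σ) (closureEmb (K := K) E (geomSqrt d)) =
              -closureEmb (K := K) E (geomSqrt d) →
            ∀ Q : localPoints Wd E, θ (σ • Q) = -(σ • θ Q)) ∧
          (∀ (σ : absoluteGaloisGroup E),
            (show AlgebraicClosure E ≃ₐ[E] AlgebraicClosure E from σ) (closureEmb (K := K) E (geomSqrt d)) =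
                closureEmb (K := K) E (geomSqrt d) ∨
              (show AlgebraicClosure E ≃ₐ[E] AlgebraicClosure E from σ) (closureEmb (K := K) E (geomSqrt d)) =
                -closureEmb (K := K) E (geomSqrt d)) ∧
          ∀ t : geomTorsion Wd (2 : ℤ),
            pointsMap W E (ψ t : geomPoints W) = θ (pointsMap Wd E (t : geomPoints Wd)) := by
  letI : Invertible (2 : K) := invertibleOfNonzero two_ne_zero
  set C₀ : VariableChange K := W.toCharNeTwoNF with hC₀
  set V : WeierstrassCurve K := C₀ • W with hVdef
  haveI : V.IsCharNeTwoNF := by rw [hVdef, hC₀]; infer_instance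
  have hV : C₀ • W = V := rfl
  have hVW : W.quadraticTwist d = V.quadraticTwist d := by
    rw [hVdef, quadraticTwist_smul]
    have h1 : (⟨C₀.u, d * C₀.r, 0, 0⟩ : VariableChange K) = 1 := by
      simp only [hC₀, toCharNeTwoNF, mul_zero]
      rfl
    rw [h1, one_smul]
  set eG : geomPoints Wd ≃+ geomPoints W :=
    (((twistPointsIso hWd).symm.trans (geomPointsCongr hVW)).trans (untwistEquiv V hd)).trans
      (twistPointsIso hV).symm with heG
  have hsign : ∀ (g : absoluteGaloisGroup K) (Q : geomPoints Wd),
      eG (g • Q) = g • eG Q ∨ eG (g • Q) = -(g • eG Q) := fun g Q ↦ by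
    rcases map_geomSqrt (absoluteGaloisGroup.toAlgEquiv K g) d with h | h
    · exact Or.inl (untwistChain_smul_of_eq hd hWd hV hVW g h Q)
    · exact Or.inr (untwistChain_smul_of_eq_neg hd hWd hV hVW g h Q)
  obtain ⟨ψ, hψ, hψe⟩ := exists_addEquiv_geomTorsion_two_of_sign eG hsign
  refine ⟨ψ, hψ, fun E _ _ ↦ ?_⟩
  set L : localPoints (V.quadraticTwist d) E ≃+ localPoints V E :=
    (show localPoints (V.quadraticTwist d) E ≃+ localPoints V E from
      (VariableChange.pointEquiv ((V.quadraticTwist d).baseChange (AlgebraicClosure E))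
          ((untwist hd).map (closureEmb (K := K) E : AlgebraicClosure K →+* AlgebraicClosure E))).trans
        (Affine.Point.congrEquiv (untwist_map_closureEmb_smul V hd E))) with hL
  have hLsome : ∀ (x y : AlgebraicClosure E)
      (h : ((V.quadraticTwist d).baseChange (AlgebraicClosure E)).toAffine.Nonsingular x y),
      ∃ h', L (show localPoints (V.quadraticTwist d) E from .some x y h) =
        (show localPoints V E from .some ((closureEmb (K := K) E (geomSqrt d) ^ 2)⁻¹ * x)
          ((closureEmb (K := K) E (geomSqrt d) ^ 3)⁻¹ * y) h') :=
    fun x y h ↦ localUntwist_some V hd E h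
  set eL : localPoints Wd E ≃+ localPoints W E :=
    (((twistLocalIso E hWd).symm.trans (localPointsCongr E hVW)).trans L).trans (twistLocalIso E hV).symm
    with heL
  refine ⟨eL, fun σ hfix Q ↦ ?_, fun σ hneg Q ↦ ?_, smul_closureEmb_geomSqrt_eq_or_eq_neg E, fun t ↦ ?_⟩
  · simp only [heL, AddEquiv.trans_apply]
    rw [symm_equivariant (twistLocalIso E hWd) (twistLocalIso_smul E hWd) σ Q, localPointsCongr_smul,
      localUntwist_smul_of_fix V E L hLsome σ hfix,
      symm_equivariant (twistLocalIso E hV) (twistLocalIso_smul E hV) σ]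
  · simp only [heL, AddEquiv.trans_apply]
    rw [symm_equivariant (twistLocalIso E hWd) (twistLocalIso_smul E hWd) σ Q, localPointsCongr_smul,
      localUntwist_smul_of_neg V E L hLsome σ hneg, map_neg,
      symm_equivariant (twistLocalIso E hV) (twistLocalIso_smul E hV) σ]
  · rw [hψe t]
    simp only [heG, heL, AddEquiv.trans_apply]
    rw [pointsMap_twistPointsIso_symm hV E, pointsMap_untwistEquiv V hd E L hLsome,
      pointsMap_geomPointsCongr E hVW, pointsMap_twistPointsIso_symm hWd E]

end Signed

end Summit.BirchSwinnertonDyer.BirchSwinnertonDyer.Theorems.GenusKolyTwistLocal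

end
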